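import Summits.BirchSwinnertonDyer.BirchSwinnertonDyer.Theorems.PrintCFramBottomClassIndexLawFiveLeKolyvaginTransport
import HarnessLib

/-!
# Route `PrintCFram`, crux C2 `BottomClassIndexLawFiveLe` (stmt-BirchSwinnertonDyer-20372), line `eisenstein-resource-bdp-line`:
# the Kolyvagin inequality as a SUM OVER AN ISOGENY PAIR — the output shape of the `𝓞_𝔭`-linear argument over `F = K·K''` — and the v9 END STATE

Cell `bsd-print-cfram`, LEAD seat `bsd-line-cfram-p1` (generation g6), `--supports stmt-BirchSwinnertonDyer-20372` (helper); sequel of `…KolyvaginTransport`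
(p637898) and `…EisensteinEndStateV8` (p639702). HONEST FRAMING. The crux C2 is CLASS-WIDE and stays OPEN; no definition, no named fact, no `sorry`;
CONDITIONAL on the displayed published facts and the two RESEARCH statements of the skeleton. BSD is not proved by any of this; no summit statement
is proved by this seat.

WHY A PAIR. The line card of `borel_heegner_squeeze` and its H1-check memo (bsd-idea-7 g4, `Lines/borel-heegner-squeeze-H1check.md` §§3–4) record the one
obstruction of Kolyvagin's argument at the Borel CM-ramified prime — Selmer classes valued in the `τ`-eigenline `W[𝔭]` of the wrong sign are invisible to
every Kolyvagin prime (Gross's Prop. 5.3 step (γ)) — and its removal: over `F = K·K''` the Tate module is `𝓞_𝔭`-linear of rank one,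
`Sel_{p^∞}(W/F) = Sel(W/K'') ⊕ Sel(W ⊗ ε_K/K'')` with `W ⊗ ε_K ≅ W/W[𝔭]` ISOGENOUS to `W`, so «the `𝓞_𝔭`-Kolyvagin bound over `F` reads `a + a' ≤ b + b'`
and Cassels + Gross–Zagier give `a − b = a' − b'` ⇒ UPPER for `W`». This file makes the second half of that sentence a THEOREM and types the first half as the
stub: since the LOWER half `b ≤ a` holds for EVERY model at every datum (print on the Kriz–Li locus, β1 off it), the SUM inequality over ANY two isogenous
models at any two Heegner data over the same admissible field already gives the UPPER half for the first model (`a ≤ b + (b' − a') ≤ b`), hence `BSD_p`.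
* §7 `sha_le_index_of_pairSum_of_indexLower` (the arithmetic); `bsdp_cmRamified_of_krizLiDatum_of_isIsogenous_pairSum` (Kriz–Li locus);
  `bsdp_cmRamified_of_flatIncl_of_isIsogenous_pairSum` (off the locus, β1 for both models).
* §8 `bottomClassIndexLawFiveLe_of_prints7_of_krizLi_of_kolyvaginPairSum_of_flatInclOffKrizLi` — the v9 END STATE with the stub
  `stub_kolyvaginUpper_borelCM_pairSum`: for every member `W` and admissible Heegner field `K''`, SOME two globally minimal models `W₀ ∼ W ∼ W₁` and SOME
  Heegner data `(Dt₀,P₀)`, `(Dt₁,P₁)` of them over `K''` satisfy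
  `ord_p#Ш(W₀/K'') + 2v_p(c₀) + ord_p#Ш(W₁/K'') + 2v_p(c₁) ≤ 2ord_p[W₀(K''):ℤP₀] + 2ord_p[W₁(K''):ℤP₁]` (v8's one-model stub implies it with `W₁ = W₀`).

References: [GrigorovJorzaPatrikisSteinTarnita2009] Thm. 3.7, Props. 5.2–5.4; [Gross1991] §§3–5; [Cassels1965ArithmeticVIII]; [MilneADT2006] Thm. I.7.3;
[GrossZagier1986] I.(6.3), Thm. I.7.3; [KrizLi2019] Thm. 1.20; [JetchevSkinnerWan2017] §7.4.1.
-/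



set_option autoImplicit false
-- the summit namespace `Summit.BirchSwinnertonDyer.BirchSwinnertonDyer` repeats the problem name by design (D-0017)
set_option linter.dupNamespace false

noncomputable section

open scoped Classical

namespace Summit.BirchSwinnertonDyer.BirchSwinnertonDyer.Theorems.PrintCFram.KrizLiKolyvagin

open WeierstrassCurve NumberField IsDedekindDomain Field PowerSeries
  Literature.NumberTheory.EllipticCurves Literature.NumberTheory.EllipticCurves.GreenbergSelmer
  Literature.NumberTheory.EllipticCurves.GreenbergVatsal2000
  Literature.NumberTheory.EllipticCurves.ModularForms
  Literature.NumberTheory.EllipticCurves.KrizLi2019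
  Literature.NumberTheory.GaloisCohomology
  Literature.NumberTheory.EllipticCurves.Rank1Residual
  Literature.NumberTheory.EllipticCurves.Rank1Residual.Typed
  Literature.NumberTheory.GaloisRepresentations
  Summit.BirchSwinnertonDyer.Rank1Residual
  Summit.BirchSwinnertonDyer.Rank1Residual.Additive
  Summit.BirchSwinnertonDyer.Rank1Residual.X11b Summit.BirchSwinnertonDyer.Rank1Residual.X11b.AcSelmer
  Summit.BirchSwinnertonDyer.Rank1Residual.X11b.Halves
  Summit.BirchSwinnertonDyer.Rank1Residual.X12
  Summit.BirchSwinnertonDyer.Rank1Residual.X2.ResidualDevissageModules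
  Summit.BirchSwinnertonDyer.BirchSwinnertonDyer.Theses.UniversalToricDescent
  Summit.BirchSwinnertonDyer.BirchSwinnertonDyer.Theorems
  Summit.BirchSwinnertonDyer.BirchSwinnertonDyer.Theorems.SchneiderFree
  Summit.BirchSwinnertonDyer.BirchSwinnertonDyer.Theorems.UniversalToricDescentWaldspurgerFlat
  Summit.BirchSwinnertonDyer.BirchSwinnertonDyer.Theorems.UniversalToricDescentStrictPlace
  Summit.BirchSwinnertonDyer.BirchSwinnertonDyer.Theorems.RamifiedSevenEllipticUnits
  Summit.BirchSwinnertonDyer.BirchSwinnertonDyer.Theorems.PrintCFram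
  Summit.BirchSwinnertonDyer.BirchSwinnertonDyer.Theorems.PrintCFram.EisensteinResourceBdpLine

/-! ## §7 The Kolyvagin inequality as a sum over an isogeny pair -/

section PairSum

variable {p : ℕ} [Fact p.Prime]

/-- **The arithmetic of the pair.** If `a₀ + a₁ ≤ b₀ + b₁` (the summed Tamagawa-free inequality over two models `W₀, W₁` at two data) and the LOWER
index half holds for `W₁` at its datum (`b₁ ≤ a₁ + 2·ord_p ∏c_ℓ(W₁) = a₁`, the Tamagawa term being void for CM and `p ≥ 5`), then `a₀ ≤ b₀` — the
Tamagawa-free UPPER half for `W₀`. [cite: JetchevSkinnerWan2017, §7.4.1 (arXiv:1512.06894 p. 30)] [cite: SilvermanATAEC1994, Cor. IV.9.2(d)] -/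
theorem sha_le_index_of_pairSum_of_indexLower
    {W₀ W₁ : WeierstrassCurve ℚ} [W₁.IsElliptic] (hCM₁ : W₁.HasCM) (h5 : 5 ≤ p)
    {K : Type} [Field K] [NumberField K] {P₀ : (W₀.baseChange K).toAffine.Point} {P₁ : (W₁.baseChange K).toAffine.Point} {s₀ s₁ : ℕ}
    (hsum : padicValNat p (W₀.baseChange K).shaOrder + 2 * s₀ + (padicValNat p (W₁.baseChange K).shaOrder + 2 * s₁) ≤
      2 * padicValNat p (AddSubgroup.zmultiples P₀).index + 2 * padicValNat p (AddSubgroup.zmultiples P₁).index)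
    (hlo₁ : IndexLowerBoundLeAt W₁ p K P₁ s₁) :
    padicValNat p (W₀.baseChange K).shaOrder + 2 * s₀ ≤ 2 * padicValNat p (AddSubgroup.zmultiples P₀).index := by
  have hp : p.Prime := Fact.out
  have htam : padicValNat p W₁.tamagawaProduct = 0 :=
    padicValNat.eq_zero_of_not_dvd (X12.O11.RouteU.not_dvd_tamagawaProduct_of_hasCM W₁ hCM₁ p hp h5)
  unfold IndexLowerBoundLeAt at hlo₁
  rw [htam] at hlo₁
  omega

/-- **Kriz–Li locus, pair form: `BSD_p(W)` from the SUMMED Kolyvagin inequality over two isogenous models `W₀ ∼ W ∼ W₁` at two Heegner data over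
the Kriz–Li field `K''`.** LOWER for `W₁` is print (§1 of `…KrizLiLocusKolyvagin` after transporting the binders), so the sum gives the UPPER half for
`W₀` (`sha_le_index_of_pairSum_of_indexLower`), and `bsdp_cmRamified_of_krizLiDatum_of_isIsogenous_indexUpper` concludes. CONDITIONAL.
[cite: KrizLi2019, Thm. 1.20 (pp. 7–8)] [cite: MilneADT2006, Thm. I.7.3] [cite: GrossZagier1986, I.(6.3)] -/
theorem bsdp_cmRamified_of_krizLiDatum_of_isIsogenous_pairSum
    (hprints : Hsieh2014.thmA_exists_isHsiehLFunction_unrPeriod_anyLevel ∧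
      LiuZhangZhang2018.thm151_thm153_modularCurve_heegnerVector_additive ∧
      ToricPublishedInputs ∧
      (∀ (K : Type) [Field K] [NumberField K], poitouTate_sha_tateDual K) ∧
      bsdTriple_of_hasCM_of_L_one_ne_zero ∧ hasEntireLFunction_rat ∧ bsdRHS_eq_of_isIsogenous)
    (hKL : KrizLi2019.thm120_padicLogHeegner_unit_of_bernoulli)
    (W : WeierstrassCurve ℚ) [W.IsElliptic] [W.IsGloballyMinimal] (hCM : W.HasCM) (hram : CMRamified W p) (h5 : 5 ≤ p)
    (hr : W.analyticRank = 1)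
    (N : ℕ) [NeZero N] (K : Type) [Field K] [NumberField K]
    (hN : W.conductorNorm ℤ = N) (hK : IsImaginaryQuadratic K) (hHN : SatisfiesHeegnerHypothesis N K)
    (hodd : Odd (NumberField.discr K)) (hd4 : NumberField.discr K < -4)
    (hLt : (W.quadraticTwist (NumberField.discr K : ℚ)).entireLFunction 1 ≠ 0)
    (f : ℕ) [NeZero f] (ψ : DirichletCharacter ℚ_[p] f) (ω : DirichletCharacter ℚ_[p] p)
    (hψ : ψ.IsPrimitive) (hω : KrizLi2019.IsTeichmullerCharacter ω)
    (hss : ∀ ℓ : ℕ, ℓ.Prime → ¬ (ℓ ∣ p * W.conductorNorm ℤ) →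
      ‖((W.LFunction ℓ : ℤ) : ℚ_[p]) - (ψ (ℓ : ZMod f) + ψ⁻¹ (ℓ : ZMod f) * ω (ℓ : ZMod p))‖ < 1)
    (h1 : ψ (p : ZMod f) ≠ 1) (h1' : KrizLi2019.primVal (KrizLi2019.invMulOmega ψ ω) p ≠ 1)
    (h3 : ∀ ℓ : ℕ, (hℓ : ℓ.Prime) → ℓ ≠ p →
      (haveI := Fact.mk hℓ; ¬ W.HasGoodReductionAtPrime ℓ ∧ ¬ W.HasMultiplicativeReductionAtPrime ℓ) →
      ψ (ℓ : ZMod f) ≠ 1 ∧ KrizLi2019.primVal (KrizLi2019.invMulOmega ψ ω) ℓ ≠ 1)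
    (εK : DirichletCharacter ℚ_[p] (NumberField.discr K).natAbs) (hεK : KrizLi2019.IsKroneckerCharacterOf K εK)
    (h4 : ¬ (‖KrizLi2019.bernoulliOnePrim (KrizLi2019.bernoulliCharOne ψ εK) *
        KrizLi2019.bernoulliOnePrim (KrizLi2019.bernoulliCharTwo ψ εK ω)‖ ≤ (p : ℝ)⁻¹))
    (W₀ : WeierstrassCurve ℚ) [W₀.IsElliptic] [W₀.IsGloballyMinimal] (hiso₀ : IsIsogenous W W₀)
    (W₁ : WeierstrassCurve ℚ) [W₁.IsElliptic] [W₁.IsGloballyMinimal] (hiso₁ : IsIsogenous W W₁)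
    (Dt₀ : ModularParametrizationData W₀ N) (H₀ : HeegnerDatum N (NumberField.discr K)) (ι₀ : K →+* ℂ)
    (P₀ : (W₀.baseChange K).toAffine.Point)
    (hP₀ : WeierstrassCurve.Affine.Point.map ι₀.toRatAlgHom P₀ = heegnerPointComplex Dt₀ H₀)
    (Dt₁ : ModularParametrizationData W₁ N) (H₁ : HeegnerDatum N (NumberField.discr K)) (ι₁ : K →+* ℂ)
    (P₁ : (W₁.baseChange K).toAffine.Point)
    (hP₁ : WeierstrassCurve.Affine.Point.map ι₁.toRatAlgHom P₁ = heegnerPointComplex Dt₁ H₁)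
    (hsum : padicValNat p (W₀.baseChange K).shaOrder + 2 * padicValNat p Dt₀.c.natAbs +
        (padicValNat p (W₁.baseChange K).shaOrder + 2 * padicValNat p Dt₁.c.natAbs) ≤
      2 * padicValNat p (AddSubgroup.zmultiples P₀).index + 2 * padicValNat p (AddSubgroup.zmultiples P₁).index) :
    BSDp W p := by
  obtain ⟨-, -, hF, hPT2, -, hmod, -⟩ := id hprints
  obtain ⟨hGZ, hKo, -, -, hmodP, -, -, -, -, -⟩ := id hF
  -- the second model is on the class and carries the Kriz–Li binders: its LOWER half is print
  have hCM₁ : W₁.HasCM := X12.hasCM_of_isIsogenous hiso₁ hCM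
  have hram₁ : CMRamified W₁ p := (X12.cmRamified_iff_of_isIsogenous hiso₁ hCM p).mp hram
  have hr₁ : W₁.analyticRank = 1 := by rw [← analyticRank_eq_of_isIsogenous LFunction_eq_of_isIsogenous_holds hiso₁]; exact hr
  obtain ⟨hN₁, hss₁, h3₁⟩ := krizLiBinders_of_isIsogenous hmodP hiso₁ hCM ψ ω hss h3
  have hD0 : (NumberField.discr K : ℚ) ≠ 0 := by exact_mod_cast NumberField.discr_ne_zero K
  haveI : (W.quadraticTwist (NumberField.discr K : ℚ)).IsElliptic := W.isElliptic_quadraticTwist hD0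
  haveI : (W₁.quadraticTwist (NumberField.discr K : ℚ)).IsElliptic := W₁.isElliptic_quadraticTwist hD0
  have hLt₁ : (W₁.quadraticTwist (NumberField.discr K : ℚ)).entireLFunction 1 ≠ 0 := by
    rw [← entireLFunction_eq_of_isIsogenous LFunction_eq_of_isIsogenous_holds (hiso₁.quadraticTwist hD0)]; exact hLt
  have hL0 : W₁.entireLFunction 1 = 0 := entireLFunction_one_eq_zero_of_analyticRank_eq_one hr₁
  obtain ⟨-, hderiv⟩ := leadingLCoeff_eq_deriv_of_analyticRank_eq_one hr₁
  have hLK : LDerivEK W₁ K ≠ 0 := by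
    rw [lDerivEK_eq_deriv_mul W₁ K hmod hL0]; exact mul_ne_zero hderiv hLt₁
  have hnt₁ : ¬ IsOfFinAddOrder P₁ :=
    (lDerivEK_ne_zero_iff_not_isOfFinAddOrder W₁ N K (hGZ _ W₁ K) hK hHN ⟨Dt₁, H₁, ι₁, hP₁⟩).mp hLK
  have hlo₁ : IndexLowerBoundLeAt W₁ p K P₁ (padicValNat p Dt₁.c.natAbs) :=
    indexLowerBoundLeAt_cmRamified_of_krizLiDatum hPT2 hKo hKL W₁ hCM₁ hram₁ h5 N K Dt₁ H₁ ι₁ P₁ (hN₁.trans hN) hK hHN hLt₁ hP₁ hnt₁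
      f ψ ω hψ hω hss₁ h1 h1' h3₁ εK hεK h4
  have hup₀ := sha_le_index_of_pairSum_of_indexLower hCM₁ h5 hsum hlo₁
  exact bsdp_cmRamified_of_krizLiDatum_of_isIsogenous_indexUpper hprints hKL W hCM hram h5 hr N K hN hK hHN hodd hd4 hLt f ψ ω hψ hω hss h1
    h1' h3 εK hεK h4 W₀ hiso₀ Dt₀ H₀ ι₀ P₀ hP₀ (fun _ ↦ hup₀)

/-- **Off the locus, pair form: `BSD_p(W)` from β1 for two isogenous models `W₀ ∼ W ∼ W₁` and the SUMMED Kolyvagin inequality at two Heegner data over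
an admissible field.** LOWER for `W₁` from β1 pointwise; the sum gives UPPER for `W₀`; `bsdp_cmRamified_of_flatIncl_of_isIsogenous_indexUpper` concludes.
CONDITIONAL. [cite: JetchevSkinnerWan2017, §7.4.1 (arXiv:1512.06894 p. 30)] [cite: MilneADT2006, Thm. I.7.3] [cite: Hsieh2014, Thm. A p. 712 (Doc. Math. 19)] -/
theorem bsdp_cmRamified_of_flatIncl_of_isIsogenous_pairSum
    (hprints : Hsieh2014.thmA_exists_isHsiehLFunction_unrPeriod_anyLevel ∧
      LiuZhangZhang2018.thm151_thm153_modularCurve_heegnerVector_additive ∧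
      ToricPublishedInputs ∧
      (∀ (K : Type) [Field K] [NumberField K], poitouTate_sha_tateDual K) ∧
      bsdTriple_of_hasCM_of_L_one_ne_zero ∧ hasEntireLFunction_rat ∧ bsdRHS_eq_of_isIsogenous)
    (W : WeierstrassCurve ℚ) [W.IsElliptic] [W.IsGloballyMinimal] (hCM : W.HasCM) (hram : CMRamified W p) (h5 : 5 ≤ p)
    (hr : W.analyticRank = 1)
    (N : ℕ) [NeZero N] (K : Type) [Field K] [NumberField K]
    (hN : W.conductorNorm ℤ = N) (hK : IsImaginaryQuadratic K) (hHN : SatisfiesHeegnerHypothesis N K)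
    (hodd : Odd (NumberField.discr K)) (hd4 : NumberField.discr K < -4)
    (hLt : (W.quadraticTwist (NumberField.discr K : ℚ)).entireLFunction 1 ≠ 0)
    (W₀ : WeierstrassCurve ℚ) [W₀.IsElliptic] [W₀.IsGloballyMinimal] (hiso₀ : IsIsogenous W W₀)
    (W₁ : WeierstrassCurve ℚ) [W₁.IsElliptic] [W₁.IsGloballyMinimal] (hiso₁ : IsIsogenous W W₁)
    (Dt₀ : ModularParametrizationData W₀ N) (H₀ : HeegnerDatum N (NumberField.discr K)) (ι₀ : K →+* ℂ)
    (P₀ : (W₀.baseChange K).toAffine.Point)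
    (hP₀ : WeierstrassCurve.Affine.Point.map ι₀.toRatAlgHom P₀ = heegnerPointComplex Dt₀ H₀)
    (Dt₁ : ModularParametrizationData W₁ N) (H₁ : HeegnerDatum N (NumberField.discr K)) (ι₁ : K →+* ℂ)
    (P₁ : (W₁.baseChange K).toAffine.Point)
    (hP₁ : WeierstrassCurve.Affine.Point.map ι₁.toRatAlgHom P₁ = heegnerPointComplex Dt₁ H₁)
    (hIncl₀ : ∀ (κ : ZpExtension K p), κ.IsAnticyclotomic → ∀ (γ : Field.absoluteGaloisGroup K) [Fact (κ.IsTopGenerator γ)]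
        (𝔭 : HeightOneSpectrum (𝓞 K)), ((p : ℕ) : 𝓞 K) ∈ 𝔭.asIdeal → 𝔭.asIdeal.ramificationIdx (𝓞 ℚ) = 1 →
        𝔭.asIdeal.inertiaDeg (𝓞 ℚ) = 1 → ∀ (𝔭' : HeightOneSpectrum (𝓞 K)), ((p : ℕ) : 𝓞 K) ∈ 𝔭'.asIdeal → 𝔭' ≠ 𝔭 →
        ∀ (ι' : PadicAlgCl p ≃+* ℂ), SchneiderFree.BranchInducesPrime p ι' 𝔭 →
        ∀ (ΩK : ℂ) (Ωp : ℂ_[p]) (Q : PowerSeries (PadicComplexInt p)), ΩK ≠ 0 → Ωp ≠ 0 →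
          R1.IsBDPLFunctionInt p ι' 𝔭 κ γ Dt₀.f ΩK Ωp Q →
          Module.IsTorsion (IwasawaAlgebra p) (XAc (W₀.baseChange K) p κ 𝔭' ∅ γ) →
          (XAc.charIdeal (W₀.baseChange K) p κ 𝔭' ∅ γ).map (PowerSeries.map (R1.toCpInt p)) ≤ Ideal.span {Q})
    (hIncl₁ : ∀ (κ : ZpExtension K p), κ.IsAnticyclotomic → ∀ (γ : Field.absoluteGaloisGroup K) [Fact (κ.IsTopGenerator γ)]
        (𝔭 : HeightOneSpectrum (𝓞 K)), ((p : ℕ) : 𝓞 K) ∈ 𝔭.asIdeal → 𝔭.asIdeal.ramificationIdx (𝓞 ℚ) = 1 →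
        𝔭.asIdeal.inertiaDeg (𝓞 ℚ) = 1 → ∀ (𝔭' : HeightOneSpectrum (𝓞 K)), ((p : ℕ) : 𝓞 K) ∈ 𝔭'.asIdeal → 𝔭' ≠ 𝔭 →
        ∀ (ι' : PadicAlgCl p ≃+* ℂ), SchneiderFree.BranchInducesPrime p ι' 𝔭 →
        ∀ (ΩK : ℂ) (Ωp : ℂ_[p]) (Q : PowerSeries (PadicComplexInt p)), ΩK ≠ 0 → Ωp ≠ 0 →
          R1.IsBDPLFunctionInt p ι' 𝔭 κ γ Dt₁.f ΩK Ωp Q →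
          Module.IsTorsion (IwasawaAlgebra p) (XAc (W₁.baseChange K) p κ 𝔭' ∅ γ) →
          (XAc.charIdeal (W₁.baseChange K) p κ 𝔭' ∅ γ).map (PowerSeries.map (R1.toCpInt p)) ≤ Ideal.span {Q})
    (hsum : padicValNat p (W₀.baseChange K).shaOrder + 2 * padicValNat p Dt₀.c.natAbs +
        (padicValNat p (W₁.baseChange K).shaOrder + 2 * padicValNat p Dt₁.c.natAbs) ≤
      2 * padicValNat p (AddSubgroup.zmultiples P₀).index + 2 * padicValNat p (AddSubgroup.zmultiples P₁).index) :
    BSDp W p := by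
  have hp : p.Prime := Fact.out
  have hp2 : p ≠ 2 := by omega
  obtain ⟨hA, hL, hF, hPT2, -, hmod, -⟩ := id hprints
  obtain ⟨hGZ, hKo, -, -, hmodP, -, -, -, -, -⟩ := id hF
  obtain ⟨hPT, hEP, hcd, hBr⟩ := EisensteinResourceBdpLine.prints_four_hold
  -- LOWER for the second model from β1 (pointwise at its datum)
  have hCM₁ : W₁.HasCM := X12.hasCM_of_isIsogenous hiso₁ hCM
  have hram₁ : CMRamified W₁ p := (X12.cmRamified_iff_of_isIsogenous hiso₁ hCM p).mp hram
  have hr₁ : W₁.analyticRank = 1 := by rw [← analyticRank_eq_of_isIsogenous LFunction_eq_of_isIsogenous_holds hiso₁]; exact hr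
  have hN₁ : W₁.conductorNorm ℤ = N := (conductorNorm_eq_of_isIsogenous_of_modularity hmodP W W₁ hiso₁).symm.trans hN
  have hD0 : (NumberField.discr K : ℚ) ≠ 0 := by exact_mod_cast NumberField.discr_ne_zero K
  haveI : (W.quadraticTwist (NumberField.discr K : ℚ)).IsElliptic := W.isElliptic_quadraticTwist hD0
  haveI : (W₁.quadraticTwist (NumberField.discr K : ℚ)).IsElliptic := W₁.isElliptic_quadraticTwist hD0
  have hLt₁ : (W₁.quadraticTwist (NumberField.discr K : ℚ)).entireLFunction 1 ≠ 0 := by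
    rw [← entireLFunction_eq_of_isIsogenous LFunction_eq_of_isIsogenous_holds (hiso₁.quadraticTwist hD0)]; exact hLt
  have hadd₁ : Addv W₁ p := addv_of_cmRamified W₁ hCM₁ hram₁ h5
  have hpN : p ∣ N := by rw [← hN₁]; exact (W₁.dvd_conductorNorm_iff_not_hasGoodReductionAtPrime p).mpr hadd₁.1
  have hL0 : W₁.entireLFunction 1 = 0 := entireLFunction_one_eq_zero_of_analyticRank_eq_one hr₁
  obtain ⟨-, hderiv⟩ := leadingLCoeff_eq_deriv_of_analyticRank_eq_one hr₁
  have hLK : LDerivEK W₁ K ≠ 0 := by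
    rw [lDerivEK_eq_deriv_mul W₁ K hmod hL0]; exact mul_ne_zero hderiv hLt₁
  have hnt₁ : ¬ IsOfFinAddOrder P₁ :=
    (lDerivEK_ne_zero_iff_not_isOfFinAddOrder W₁ N K (hGZ _ W₁ K) hK hHN ⟨Dt₁, H₁, ι₁, hP₁⟩).mp hLK
  have hCtl₁ := additiveControl_heegner_of_cmRamified (p := p) hPT hPT2 hEP hcd hBr W₁ hCM₁ hram₁ h5
  have hlo₁ : IndexLowerBoundLeAt W₁ p K P₁ (padicValNat p Dt₁.c.natAbs) :=
    indexLowerBoundLeAt_of_flatInclLe_of_control hp2 hA hL Dt₁ H₁ ι₁ P₁ hadd₁ hN₁ hK hHN hd4 hP₁ hnt₁ (hKo N W₁ K)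
      (fun κ hκ γ _ 𝔭 h𝔭 he hf 𝔭' h𝔭' hne ι' hind ΩK Ωp Q hΩK hΩp hBDP ↦ by
        obtain ⟨he', hf'⟩ := degreeOne_of_dvd_of_heegner hK hHN hpN h𝔭'
        obtain ⟨n, hn, -⟩ := hCtl₁ N K Dt₁ H₁ ι₁ P₁ hN₁ hK hHN hLt₁ hP₁ hnt₁ (hKo N W₁ K) κ hκ γ 𝔭' h𝔭' he' hf'
        exact hIncl₁ κ hκ γ 𝔭 h𝔭 he hf 𝔭' h𝔭' hne ι' hind ΩK Ωp Q hΩK hΩp hBDP hn.1)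
      (fun κ hκ γ _ 𝔭 h𝔭 he hf ↦ hCtl₁ N K Dt₁ H₁ ι₁ P₁ hN₁ hK hHN hLt₁ hP₁ hnt₁ (hKo N W₁ K) κ hκ γ 𝔭 h𝔭 he hf)
  have hup₀ := sha_le_index_of_pairSum_of_indexLower hCM₁ h5 hsum hlo₁
  exact bsdp_cmRamified_of_flatIncl_of_isIsogenous_indexUpper hprints W hCM hram h5 hr N K hN hK hHN hodd hd4 hLt W₀ hiso₀ Dt₀ H₀ ι₀ P₀
    hP₀ hIncl₀ (fun _ ↦ hup₀)

end PairSum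

/-! ## §8 The v9 END STATE: the pair-sum Kolyvagin stub -/

section EndStateV9

/-- **END STATE v9 of line `eisenstein-resource-bdp-line`: `BottomClassIndexLawFiveLe` BY NAME from** prints7, Kriz–Li Thm. 1.20, β1 off the Kriz–Li locus,
and the PAIR-SUM Kolyvagin stub `stub_kolyvaginUpper_borelCM_pairSum`: for every member `W` and every admissible Heegner field `K''` SOME two globally
minimal models `W₀ ∼ W ∼ W₁` and SOME Heegner data of them over `K''` satisfy the summed Tamagawa-free inequality
`ord_p#Ш(W₀/K'') + 2v_p(c₀) + ord_p#Ш(W₁/K'') + 2v_p(c₁) ≤ 2ord_p[W₀(K''):ℤP₀] + 2ord_p[W₁(K''):ℤP₁]` — the shape of the `𝓞_𝔭`-Kolyvagin bound over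
`F = K·K''` (H1-check memo §4), both eigenlines at once. Pointwise: Kriz–Li datum ⟹ `bsdp_cmRamified_of_krizLiDatum_of_isIsogenous_pairSum`; none ⟹ a
Friedberg–Hoffstein field and `bsdp_cmRamified_of_flatIncl_of_isIsogenous_pairSum` (β1 for both models — neither has a Kriz–Li datum,
`exists_krizLiDatum_of_isIsogenous`). CONDITIONAL; the stub and β1 are RESEARCH. BSD is not proved by any of this.
[cite: GrigorovJorzaPatrikisSteinTarnita2009, Thm. 3.7 and Props. 5.2–5.4] [cite: Gross1991, §§3–5] [cite: KrizLi2019, Thm. 1.20 (pp. 7–8)]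
[cite: FriedbergHoffstein1995, Thm. B] [cite: MilneADT2006, Thm. I.7.3] -/
theorem bottomClassIndexLawFiveLe_of_prints7_of_krizLi_of_kolyvaginPairSum_of_flatInclOffKrizLi
    (hprints : Hsieh2014.thmA_exists_isHsiehLFunction_unrPeriod_anyLevel ∧
      LiuZhangZhang2018.thm151_thm153_modularCurve_heegnerVector_additive ∧
      ToricPublishedInputs ∧
      (∀ (K : Type) [Field K] [NumberField K], poitouTate_sha_tateDual K) ∧
      bsdTriple_of_hasCM_of_L_one_ne_zero ∧ hasEntireLFunction_rat ∧ bsdRHS_eq_of_isIsogenous)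
    (hKL : KrizLi2019.thm120_padicLogHeegner_unit_of_bernoulli)
    (hKoSum : ∀ (W : WeierstrassCurve ℚ) [W.IsElliptic] [W.IsGloballyMinimal] (p : ℕ) [Fact p.Prime],
      W.HasCM → CMRamified W p → 5 ≤ p → W.analyticRank = 1 →
      ∀ (N : ℕ) [NeZero N] (K : Type) [Field K] [NumberField K],
        W.conductorNorm ℤ = N → IsImaginaryQuadratic K → Odd (NumberField.discr K) → NumberField.discr K < -4 →
        SatisfiesHeegnerHypothesis N K → (W.quadraticTwist (NumberField.discr K : ℚ)).entireLFunction 1 ≠ 0 →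
        ∃ (W₀ : WeierstrassCurve ℚ) (_ : W₀.IsElliptic) (_ : W₀.IsGloballyMinimal)
          (W₁ : WeierstrassCurve ℚ) (_ : W₁.IsElliptic) (_ : W₁.IsGloballyMinimal)
          (Dt₀ : ModularParametrizationData W₀ N) (H₀ : HeegnerDatum N (NumberField.discr K)) (ι₀ : K →+* ℂ)
          (P₀ : (W₀.baseChange K).toAffine.Point)
          (Dt₁ : ModularParametrizationData W₁ N) (H₁ : HeegnerDatum N (NumberField.discr K)) (ι₁ : K →+* ℂ)
          (P₁ : (W₁.baseChange K).toAffine.Point),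
          IsIsogenous W W₀ ∧ IsIsogenous W W₁ ∧
          WeierstrassCurve.Affine.Point.map ι₀.toRatAlgHom P₀ = heegnerPointComplex Dt₀ H₀ ∧
          WeierstrassCurve.Affine.Point.map ι₁.toRatAlgHom P₁ = heegnerPointComplex Dt₁ H₁ ∧
          padicValNat p (W₀.baseChange K).shaOrder + 2 * padicValNat p Dt₀.c.natAbs +
              (padicValNat p (W₁.baseChange K).shaOrder + 2 * padicValNat p Dt₁.c.natAbs) ≤
            2 * padicValNat p (AddSubgroup.zmultiples P₀).index + 2 * padicValNat p (AddSubgroup.zmultiples P₁).index)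
    (hInclOff : ∀ (p : ℕ) [Fact p.Prime] (W : WeierstrassCurve ℚ) [W.IsElliptic] [W.IsGloballyMinimal],
      W.HasCM → CMRamified W p → 5 ≤ p → W.analyticRank = 1 →
      (¬ ∃ (N : ℕ) (_ : NeZero N) (K : Type) (_ : Field K) (_ : NumberField K) (Dt : ModularParametrizationData W N)
          (H : HeegnerDatum N (NumberField.discr K)) (ι : K →+* ℂ) (P : (W.baseChange K).toAffine.Point)
          (f : ℕ) (_ : NeZero f) (ψ : DirichletCharacter ℚ_[p] f) (ω : DirichletCharacter ℚ_[p] p)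
          (εK : DirichletCharacter ℚ_[p] (NumberField.discr K).natAbs),
          W.conductorNorm ℤ = N ∧ IsImaginaryQuadratic K ∧ SatisfiesHeegnerHypothesis N K ∧ Odd (NumberField.discr K) ∧
          NumberField.discr K < -4 ∧ (W.quadraticTwist (NumberField.discr K : ℚ)).entireLFunction 1 ≠ 0 ∧
          WeierstrassCurve.Affine.Point.map ι.toRatAlgHom P = heegnerPointComplex Dt H ∧
          ψ.IsPrimitive ∧ KrizLi2019.IsTeichmullerCharacter ω ∧
          (∀ ℓ : ℕ, ℓ.Prime → ¬ (ℓ ∣ p * W.conductorNorm ℤ) →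
            ‖((W.LFunction ℓ : ℤ) : ℚ_[p]) - (ψ (ℓ : ZMod f) + ψ⁻¹ (ℓ : ZMod f) * ω (ℓ : ZMod p))‖ < 1) ∧
          ψ (p : ZMod f) ≠ 1 ∧ KrizLi2019.primVal (KrizLi2019.invMulOmega ψ ω) p ≠ 1 ∧
          (∀ ℓ : ℕ, (hℓ : ℓ.Prime) → ℓ ≠ p →
            (haveI := Fact.mk hℓ; ¬ W.HasGoodReductionAtPrime ℓ ∧ ¬ W.HasMultiplicativeReductionAtPrime ℓ) →
            ψ (ℓ : ZMod f) ≠ 1 ∧ KrizLi2019.primVal (KrizLi2019.invMulOmega ψ ω) ℓ ≠ 1) ∧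
          KrizLi2019.IsKroneckerCharacterOf K εK ∧
          ¬ (‖KrizLi2019.bernoulliOnePrim (KrizLi2019.bernoulliCharOne ψ εK) *
              KrizLi2019.bernoulliOnePrim (KrizLi2019.bernoulliCharTwo ψ εK ω)‖ ≤ (p : ℝ)⁻¹)) →
      ∀ (N : ℕ) [NeZero N] (K : Type) [Field K] [NumberField K] (Dt : ModularParametrizationData W N),
      W.conductorNorm ℤ = N → IsImaginaryQuadratic K → SatisfiesHeegnerHypothesis N K →
      ∀ (κ : ZpExtension K p), κ.IsAnticyclotomic → ∀ (γ : Field.absoluteGaloisGroup K) [Fact (κ.IsTopGenerator γ)]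
        (𝔭 : HeightOneSpectrum (𝓞 K)), ((p : ℕ) : 𝓞 K) ∈ 𝔭.asIdeal → 𝔭.asIdeal.ramificationIdx (𝓞 ℚ) = 1 →
        𝔭.asIdeal.inertiaDeg (𝓞 ℚ) = 1 → ∀ (𝔭' : HeightOneSpectrum (𝓞 K)), ((p : ℕ) : 𝓞 K) ∈ 𝔭'.asIdeal → 𝔭' ≠ 𝔭 →
        ∀ (ι' : PadicAlgCl p ≃+* ℂ), SchneiderFree.BranchInducesPrime p ι' 𝔭 →
        ∀ (ΩK : ℂ) (Ωp : ℂ_[p]) (Q : PowerSeries (PadicComplexInt p)), ΩK ≠ 0 → Ωp ≠ 0 →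
          R1.IsBDPLFunctionInt p ι' 𝔭 κ γ Dt.f ΩK Ωp Q →
          Module.IsTorsion (IwasawaAlgebra p) (XAc (W.baseChange K) p κ 𝔭' ∅ γ) →
          (XAc.charIdeal (W.baseChange K) p κ 𝔭' ∅ γ).map (PowerSeries.map (R1.toCpInt p)) ≤ Ideal.span {Q}) :
    Summit.BirchSwinnertonDyer.BirchSwinnertonDyer.Theses.PrintCFram.BottomClassIndexLawFiveLe := by
  intro _hGZK W _ _ p _ hCM hram h5 hr
  obtain ⟨-, -, hF, -, -, -, -⟩ := id hprints
  by_cases hKLd : ∃ (N : ℕ) (_ : NeZero N) (K : Type) (_ : Field K) (_ : NumberField K) (Dt : ModularParametrizationData W N)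
          (H : HeegnerDatum N (NumberField.discr K)) (ι : K →+* ℂ) (P : (W.baseChange K).toAffine.Point)
          (f : ℕ) (_ : NeZero f) (ψ : DirichletCharacter ℚ_[p] f) (ω : DirichletCharacter ℚ_[p] p)
          (εK : DirichletCharacter ℚ_[p] (NumberField.discr K).natAbs),
          W.conductorNorm ℤ = N ∧ IsImaginaryQuadratic K ∧ SatisfiesHeegnerHypothesis N K ∧ Odd (NumberField.discr K) ∧
          NumberField.discr K < -4 ∧ (W.quadraticTwist (NumberField.discr K : ℚ)).entireLFunction 1 ≠ 0 ∧
          WeierstrassCurve.Affine.Point.map ι.toRatAlgHom P = heegnerPointComplex Dt H ∧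
          ψ.IsPrimitive ∧ KrizLi2019.IsTeichmullerCharacter ω ∧
          (∀ ℓ : ℕ, ℓ.Prime → ¬ (ℓ ∣ p * W.conductorNorm ℤ) →
            ‖((W.LFunction ℓ : ℤ) : ℚ_[p]) - (ψ (ℓ : ZMod f) + ψ⁻¹ (ℓ : ZMod f) * ω (ℓ : ZMod p))‖ < 1) ∧
          ψ (p : ZMod f) ≠ 1 ∧ KrizLi2019.primVal (KrizLi2019.invMulOmega ψ ω) p ≠ 1 ∧
          (∀ ℓ : ℕ, (hℓ : ℓ.Prime) → ℓ ≠ p →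
            (haveI := Fact.mk hℓ; ¬ W.HasGoodReductionAtPrime ℓ ∧ ¬ W.HasMultiplicativeReductionAtPrime ℓ) →
            ψ (ℓ : ZMod f) ≠ 1 ∧ KrizLi2019.primVal (KrizLi2019.invMulOmega ψ ω) ℓ ≠ 1) ∧
          KrizLi2019.IsKroneckerCharacterOf K εK ∧
          ¬ (‖KrizLi2019.bernoulliOnePrim (KrizLi2019.bernoulliCharOne ψ εK) *
              KrizLi2019.bernoulliOnePrim (KrizLi2019.bernoulliCharTwo ψ εK ω)‖ ≤ (p : ℝ)⁻¹)
  · -- ON the Kriz–Li locus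
    obtain ⟨N, _, K, _, _, Dt, H, ι, P, f, _, ψ, ω, εK, hN, hK, hHN, hodd, hd4, hLt, hP, hψ, hω, hss, h1, h1', h3, hεK, h4⟩ :=
      hKLd
    obtain ⟨W₀, _, _, W₁, _, _, Dt₀, H₀, ι₀, P₀, Dt₁, H₁, ι₁, P₁, hiso₀, hiso₁, hP₀, hP₁, hsum⟩ :=
      hKoSum W p hCM hram h5 hr N K hN hK hodd hd4 hHN hLt
    have hpr := hprints
    obtain ⟨-, -, ⟨-, -, hGZK, -⟩, -, -, hmod, hCassels⟩ := hpr
    exact RubinFormulaZpBsdp.ramifiedCMBottomClassIndexLawAtZp_of_bsdp hCassels hmod hGZK hr.le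
      (bsdp_cmRamified_of_krizLiDatum_of_isIsogenous_pairSum hprints hKL W hCM hram h5 hr N K hN hK hHN hodd hd4 hLt f ψ ω hψ hω hss
        h1 h1' h3 εK hεK h4 W₀ hiso₀ W₁ hiso₁ Dt₀ H₀ ι₀ P₀ hP₀ Dt₁ H₁ ι₁ P₁ hP₁ hsum)
  · -- OFF the Kriz–Li locus
    obtain ⟨hGZ, hKo, hGZK, hmod, hmodP, hCassels, hGZ73, hFH, hpar, hHP⟩ := id hF
    haveI hN0 : NeZero (W.conductorNorm ℤ) := ⟨W.conductorNorm_pos_holds.ne'⟩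
    have hw : W.rootNumber = -1 := by
      rcases W.rootNumber_eq_one_or with h | h
      · exfalso
        have heven : Even W.analyticRank := (hpar W).mpr h
        rw [hr] at heven
        exact Nat.not_even_one heven
      · exact h
    obtain ⟨K, _, _, hK, -, hHN, hH6, hLt⟩ := hFH W hw 6 (by norm_num) 0
    have hodd : Odd (NumberField.discr K) := by
      have h8 := Literature.SatisfiesHeegnerHypothesis.discr_emod_eight hK.1 hH6 (by norm_num : (2 : ℕ) ∣ 6)
      rw [Int.odd_iff]; omega
    have hd4 : NumberField.discr K < -4 :=
      discr_lt_neg_four_of_three_split hK (hH6 3 Nat.prime_three (by norm_num : (3 : ℕ) ∣ 6))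
    obtain ⟨W₀, _, _, W₁, _, _, Dt₀, H₀, ι₀, P₀, Dt₁, H₁, ι₁, P₁, hiso₀, hiso₁, hP₀, hP₁, hsum⟩ :=
      hKoSum W p hCM hram h5 hr (W.conductorNorm ℤ) K rfl hK hodd hd4 hHN hLt
    have hCM₀ : W₀.HasCM := X12.hasCM_of_isIsogenous hiso₀ hCM
    have hram₀ : CMRamified W₀ p := (X12.cmRamified_iff_of_isIsogenous hiso₀ hCM p).mp hram
    have hr₀ : W₀.analyticRank = 1 := by rw [← analyticRank_eq_of_isIsogenous LFunction_eq_of_isIsogenous_holds hiso₀]; exact hr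
    have hN₀ : W₀.conductorNorm ℤ = W.conductorNorm ℤ := (conductorNorm_eq_of_isIsogenous_of_modularity hmodP W W₀ hiso₀).symm
    have hCM₁ : W₁.HasCM := X12.hasCM_of_isIsogenous hiso₁ hCM
    have hram₁ : CMRamified W₁ p := (X12.cmRamified_iff_of_isIsogenous hiso₁ hCM p).mp hram
    have hr₁ : W₁.analyticRank = 1 := by rw [← analyticRank_eq_of_isIsogenous LFunction_eq_of_isIsogenous_holds hiso₁]; exact hr
    have hN₁ : W₁.conductorNorm ℤ = W.conductorNorm ℤ := (conductorNorm_eq_of_isIsogenous_of_modularity hmodP W W₁ hiso₁).symm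
    -- neither model has a Kriz–Li datum
    have hKLd₀ := fun h ↦ hKLd (exists_krizLiDatum_of_isIsogenous (p := p) hF hiso₀.symm_of_charZero hCM₀ h)
    have hKLd₁ := fun h ↦ hKLd (exists_krizLiDatum_of_isIsogenous (p := p) hF hiso₁.symm_of_charZero hCM₁ h)
    exact RubinFormulaZpBsdp.ramifiedCMBottomClassIndexLawAtZp_of_bsdp hCassels hmod hGZK hr.le
      (bsdp_cmRamified_of_flatIncl_of_isIsogenous_pairSum hprints W hCM hram h5 hr (W.conductorNorm ℤ) K rfl hK hHN hodd hd4 hLt W₀ hiso₀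
        W₁ hiso₁ Dt₀ H₀ ι₀ P₀ hP₀ Dt₁ H₁ ι₁ P₁ hP₁
        (fun κ hκ γ _ 𝔭 h𝔭 he hf 𝔭' h𝔭' hne ι' hind ΩK Ωp Q hΩK hΩp hBDP htors ↦
          hInclOff p W₀ hCM₀ hram₀ h5 hr₀ hKLd₀ (W.conductorNorm ℤ) K Dt₀ hN₀ hK hHN κ hκ γ 𝔭 h𝔭 he hf 𝔭' h𝔭' hne ι' hind ΩK Ωp Q
            hΩK hΩp hBDP htors)
        (fun κ hκ γ _ 𝔭 h𝔭 he hf 𝔭' h𝔭' hne ι' hind ΩK Ωp Q hΩK hΩp hBDP htors ↦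
          hInclOff p W₁ hCM₁ hram₁ h5 hr₁ hKLd₁ (W.conductorNorm ℤ) K Dt₁ hN₁ hK hHN κ hκ γ 𝔭 h𝔭 he hf 𝔭' h𝔭' hne ι' hind ΩK Ωp Q
            hΩK hΩp hBDP htors)
        hsum)

end EndStateV9

end Summit.BirchSwinnertonDyer.BirchSwinnertonDyer.Theorems.PrintCFram.KrizLiKolyvagin

end
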